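import Mathlib.Analysis.SpecialFunctions.Log.Base
import Literature.Barriers.MatrixMultiplication.RectangularBarrier
import Literature.Barriers.MatrixMultiplication.UniversalMethodBarrierCor28
import Literature.Computability.AlgebraicComplexity.FlatteningBound
import HarnessLib

/-!
# Proof of CLLZ Lemma 4.2 (v): upper support functionals are bounded by the asymptotic rank

Topic `Literature/Barriers/MatrixMultiplication`; a sibling proofs file of `RectangularBarrier.lean`
(next to `RectangularBarrierProofs.lean`, which discharges Rem. 3.23) discharging its named fact
`CLLZ2025_lem42_v` (`CLLZ2025_lem42_v_holds`): for every field `K`, every `θ ∈ P([3])` and every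
3-tensor `t` with finite index types, `ζ^θ(t) ≤ R̃(t)` — item (v) of the adequacy (Def. 3.1) of
Strassen's upper support functionals, the one part of CLLZ Lemma 4.2 that the tree's
`Strassen1991_upperSupportFunctional` and Lemma 4.1 do not cover.

Source: M. Christandl, F. Le Gall, V. Lysikov, J. Zuiddam, *Barriers for rectangular matrix
multiplication*, comput. complexity 34 (2025) = arXiv:2003.03019v2, Lemma 4.2 and its proof:
"(v) follows from the fact that every upper support functional is at most the maximum of the
flattening ranks of the tensor [Str91, page 135], and the flattening ranks lower bound the
asymptotic rank" (held v1 of 2020: Lemma 3.1, last item, "at most `R̃`"). The proof below makes the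
two printed steps explicit; `ζ^θ`, `ρ^θ = log₂ ζ^θ`, `H_θ`, supports and the action
`(A ⊗ B ⊗ C)·t` are those of `Literature/Computability/AlgebraicComplexity/QuantumFunctionals.lean`
(CVZ 2023, Def. 2.1–2.3), `R̃ = asymptoticRank` and the flattening rank `ζ⁽¹⁾ = flatteningRank` those
of `AsymptoticSpectrum.lean` / `FlatteningRank.lean`.

## Proof

* **Simultaneous elimination** (`exists_gl_sum_smul_eq_zero`): for a finite family of vectors
  `v : ι → V` spanning a space of dimension `r` there is a unipotent `g = 1 − E ∈ GL_ι(K)` (`E`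
  expresses the remaining vectors in a basis `(v_s)_{s ∈ S}` extracted from the family, so `E` has
  rows outside `S` and columns inside `S`, `E² = 0`, `g⁻¹ = 1 + E`) and a set `S` of `r` indices with
  `∑_a g_{a'a} v_a = 0` for `a' ∉ S`. Applied to the three slice families of `t` (the `x`-slices of
  `t`, of `rotate t` and of `rotate (rotate t)`), the three coordinate changes act on different
  factors, so `supp((A ⊗ B ⊗ C)·t) ⊆ S₁ × S₂ × S₃` with `|S_i|` the three flattening ranks
  (`actTensor_eq_zero_of_xSlices₁/₂/₃`).
* **Entropy** (`shannonEntropy_le_log_card`, `weightedEntropy_le_of_support_subset_box`): a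
  probability distribution supported in `S₁ × S₂ × S₃` has `H(P_i) ≤ log₂ |S_i|`, so
  `H_θ(P) ≤ ∑ θ_i log₂ |S_i|`; hence `ρ^θ(t) ≤ ∑_i θ_i log₂ ζ⁽ⁱ⁾(t)`
  (`logUpperSupportFunctional_le_flatteningRank`) — Strassen's bound by the flattening ranks, in the
  weighted form which implies the printed "at most the maximum of the flattening ranks".
* **Flattening ranks and `R̃`**: `ζ⁽¹⁾ ≤ R̃` is `flatteningRank_le_asymptoticRank`
  (`UniversalMethodBarrierAsymptoticRank.lean`: `ζ⁽¹⁾` is multiplicative and `≤ R`); the other two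
  directions follow from `R̃(rotate t) = R̃(t)` (`asymptoticRank_rotate`,
  `UniversalMethodBarrierCor28.lean`, from `tensorRank_rotate`).
  With `∑ θ_i = 1`: `ζ^θ(t) = 2^{ρ^θ(t)} ≤ 2^{log₂ R̃(t)} = R̃(t)`
  (`upperSupportFunctional_le_asymptoticRank`; `ζ^θ(0) = 0 ≤ R̃(0)` separately).

## References

* M. Christandl, F. Le Gall, V. Lysikov, J. Zuiddam, comput. complexity 34 (2025), art. 4 =
  arXiv:2003.03019v2, Def. 3.1, Lemma 4.2 (v1, 2020: Lemma 3.1). [ChristandlLeGallLysikovZuiddam2025]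
* V. Strassen, *Degeneration and complexity of bilinear maps: some asymptotic spectra*, J. reine
  angew. Math. 413 (1991), Thm. 2.8 and p. 135 — cited through CLLZ.
* M. Christandl, P. Vrana, J. Zuiddam, JAMS 36 (2023), Def. 2.3 (`ζ^θ`), Example 1.4 (gauge points
  = flattening ranks). [ChristandlVranaZuiddam2023]
-/

noncomputable section

open scoped BigOperators

namespace Literature.Barriers.MatrixMultiplication

open Literature.Computability.AlgebraicComplexity

universe u

/-! ## Rotating the factors -/

section Rotate

variable {K : Type u} [CommSemiring K] {ι κ μ : Type*}

/-- A nonzero tensor stays nonzero after rotating its factors. [folklore] -/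
theorem rotate_ne_zero {t : ι → κ → μ → K} (ht : t ≠ 0) : rotate t ≠ 0 := fun h =>
  ht (funext fun a => funext fun b => funext fun c => congrFun (congrFun (congrFun h b) c) a)

end Rotate

/-! ## Flattening ranks: positivity and the bound by `R̃` in all three directions -/

section Flattening

variable {K : Type u} [Field K] {ι κ μ : Type*}

/-- A nonzero tensor has a nonzero `x`-slice, so its flattening rank is positive: `ζ⁽¹⁾(t) ≥ 1`.
[folklore] -/
theorem flatteningRank_pos [Fintype κ] [Fintype μ] {t : ι → κ → μ → K} (ht : t ≠ 0) :
    0 < flatteningRank t := by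
  obtain ⟨a, ha⟩ : ∃ a, xSlices t a ≠ 0 := by
    by_contra h
    push Not at h
    exact ht (funext fun a => funext fun b => funext fun c => congrFun (h a) (b, c))
  calc 0 < 1 := one_pos
    _ = Module.finrank K (K ∙ xSlices t a) := (finrank_span_singleton ha).symm
    _ ≤ Module.finrank K (Submodule.span K (Set.range (xSlices t))) :=
        Submodule.finrank_mono (Submodule.span_mono (Set.singleton_subset_iff.2 ⟨a, rfl⟩))
    _ = flatteningRank t := rfl

variable [Fintype ι] [Fintype κ] [Fintype μ]

/-- **The three flattening ranks are at most the asymptotic rank**, `ζ⁽ⁱ⁾(t) ≤ R̃(t)` for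
`i = 1, 2, 3`, the second and third flattening ranks written as the first flattening rank of the
rotated tensors `rotate t`, `rotate (rotate t)` (CLLZ, proof of Lemma 4.2: "the flattening ranks
lower bound the asymptotic rank"; `ζ⁽¹⁾ ≤ R̃` is `flatteningRank_le_asymptoticRank`, and
`R̃(rotate t) = R̃(t)`). [cite: ChristandlLeGallLysikovZuiddam2025, Lemma 4.2 (proof)] -/
theorem flatteningRank_rotate_le_asymptoticRank (t : ι → κ → μ → K) :
    (flatteningRank t : ℝ) ≤ asymptoticRank t ∧
      (flatteningRank (rotate t) : ℝ) ≤ asymptoticRank t ∧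
      (flatteningRank (rotate (rotate t)) : ℝ) ≤ asymptoticRank t := by
  refine ⟨flatteningRank_le_asymptoticRank t, ?_, ?_⟩
  · rw [← asymptoticRank_rotate t]
    exact flatteningRank_le_asymptoticRank _
  · rw [← asymptoticRank_rotate t, ← asymptoticRank_rotate (rotate t)]
    exact flatteningRank_le_asymptoticRank _

end Flattening

/-! ## Simultaneous elimination: a unipotent change of basis killing the dependent slices -/

section Elimination

variable {K : Type u} [Field K] {ι : Type*} [Fintype ι] [DecidableEq ι]
variable {V : Type*} [AddCommGroup V] [Module K V]

/-- **Elimination by a unipotent coordinate change.** For a finite family `v : ι → V` whose span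
has dimension `r` there are `g ∈ GL_ι(K)` and a set `S` of exactly `r` indices such that the
transformed family `a' ↦ ∑_a g_{a'a} v_a` vanishes outside `S`. (Extract from the family a basis
`(v_{f j})_j` of its span, `S = im f`; write `v_a = ∑_j c_{a j} v_{f j}` for `a ∉ S` and let `E`
be the matrix with these coefficients in the rows `a ∉ S`, columns in `S`; then `E² = 0`, so
`g = 1 − E` is invertible with inverse `1 + E`, and `∑_a g_{a'a} v_a = v_{a'} − v_{a'} = 0` for
`a' ∉ S`.) [folklore] -/
theorem exists_gl_sum_smul_eq_zero (v : ι → V) :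
    ∃ (g : GL ι K) (S : Finset ι), S.card = Module.finrank K (Submodule.span K (Set.range v)) ∧
      ∀ a', a' ∉ S → ∑ a, (g : Matrix ι ι K) a' a • v a = 0 := by
  obtain ⟨J, f, hf, hspan, hli⟩ := exists_linearIndependent' K v
  haveI : Fintype J := Fintype.ofInjective f hf
  -- every `v a` is a combination of the extracted basis `v ∘ f`
  have hmem : ∀ a, v a ∈ Submodule.span K (Set.range (v ∘ f)) := fun a => by
    rw [hspan]
    exact Submodule.subset_span ⟨a, rfl⟩
  choose c hc using fun a => (Submodule.mem_span_range_iff_exists_fun K).1 (hmem a)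
  let S : Finset ι := Finset.univ.image f
  have hfS : ∀ j, f j ∈ S := fun j => Finset.mem_image_of_mem f (Finset.mem_univ j)
  -- the elimination matrix: rows outside `S`, columns inside `S`
  let E : Matrix ι ι K := fun a a'' => if a ∈ S then 0 else ∑ j, if f j = a'' then c a j else 0
  have hEdef : ∀ a a'', E a a'' = if a ∈ S then 0 else ∑ j, if f j = a'' then c a j else 0 :=
    fun _ _ => rfl
  have hErow : ∀ a, a ∈ S → ∀ a'', E a a'' = 0 := fun a ha a'' => by rw [hEdef, if_pos ha]
  have hEcol : ∀ a a'', a'' ∉ S → E a a'' = 0 := by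
    intro a a'' ha''
    rw [hEdef]
    split_ifs
    · rfl
    · refine Finset.sum_eq_zero fun j _ => ?_
      rw [if_neg]
      rintro rfl
      exact ha'' (hfS j)
  have hE2 : E * E = 0 := by
    ext a a'
    rw [Matrix.mul_apply, Matrix.zero_apply]
    refine Finset.sum_eq_zero fun a'' _ => ?_
    by_cases ha'' : a'' ∈ S
    · rw [hErow a'' ha'', mul_zero]
    · rw [hEcol a a'' ha'', zero_mul]
  -- `∑_{a''} E_{a a''} v_{a''} = v_a` for `a ∉ S`
  have hEv : ∀ a, a ∉ S → ∑ a'', E a a'' • v a'' = v a := by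
    intro a ha
    calc ∑ a'', E a a'' • v a''
        = ∑ a'', ∑ j, (if f j = a'' then c a j else 0) • v a'' := by
          refine Finset.sum_congr rfl fun a'' _ => ?_
          rw [← Finset.sum_smul, hEdef, if_neg ha]
      _ = ∑ j, ∑ a'', (if f j = a'' then c a j else 0) • v a'' := Finset.sum_comm
      _ = ∑ j, c a j • v (f j) := by
          refine Finset.sum_congr rfl fun j _ => ?_
          simp only [ite_smul, zero_smul, Finset.sum_ite_eq, Finset.mem_univ, if_true]
      _ = v a := hc a
  refine ⟨⟨1 - E, 1 + E, ?_, ?_⟩, S, ?_, ?_⟩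
  · rw [sub_mul, one_mul, mul_add, mul_one, hE2, add_zero, add_sub_cancel_right]
  · rw [mul_sub, mul_one, add_mul, one_mul, hE2, add_zero, add_sub_cancel_right]
  · show (Finset.univ.image f).card = _
    rw [Finset.card_image_of_injective _ hf, Finset.card_univ, ← hspan, finrank_span_eq_card hli]
  · intro a' ha'
    show ∑ a, ((1 : Matrix ι ι K) - E) a' a • v a = 0
    have h1 : ∀ a, ((1 : Matrix ι ι K) - E) a' a • v a = (if a' = a then v a else 0) - E a' a • v a :=
      fun a => by rw [Matrix.sub_apply, Matrix.one_apply, sub_smul, ite_smul, one_smul, zero_smul]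
    simp only [h1]
    rw [Finset.sum_sub_distrib, Finset.sum_ite_eq, hEv a' ha', if_pos (Finset.mem_univ a'), sub_self]

end Elimination

/-! ## The support after the three eliminations -/

section SupportBox

variable {K : Type u} [Field K] {ι κ μ ι' κ' μ' : Type*} [Fintype ι] [Fintype κ] [Fintype μ]

/-- `((A ⊗ B ⊗ C)·t)_{a'b'c'} = ∑_{b,c} B_{b'b} C_{c'c} · ∑_a A_{a'a} t_{abc}`. [folklore] -/
theorem actTensor_eq_sum₁ (A : Matrix ι' ι K) (B : Matrix κ' κ K) (C : Matrix μ' μ K)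
    (t : ι → κ → μ → K) (a' : ι') (b' : κ') (c' : μ') :
    actTensor A B C t a' b' c' = ∑ b, ∑ c, B b' b * C c' c * ∑ a, A a' a * t a b c := by
  rw [actTensor_apply, Finset.sum_comm]
  refine Finset.sum_congr rfl fun b _ => ?_
  rw [Finset.sum_comm]
  refine Finset.sum_congr rfl fun c _ => ?_
  rw [Finset.mul_sum]
  exact Finset.sum_congr rfl fun a _ => by ring

/-- `((A ⊗ B ⊗ C)·t)_{a'b'c'} = ∑_{a,c} A_{a'a} C_{c'c} · ∑_b B_{b'b} t_{abc}`. [folklore] -/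
theorem actTensor_eq_sum₂ (A : Matrix ι' ι K) (B : Matrix κ' κ K) (C : Matrix μ' μ K)
    (t : ι → κ → μ → K) (a' : ι') (b' : κ') (c' : μ') :
    actTensor A B C t a' b' c' = ∑ a, ∑ c, A a' a * C c' c * ∑ b, B b' b * t a b c := by
  rw [actTensor_apply]
  refine Finset.sum_congr rfl fun a _ => ?_
  rw [Finset.sum_comm]
  refine Finset.sum_congr rfl fun c _ => ?_
  rw [Finset.mul_sum]
  exact Finset.sum_congr rfl fun b _ => by ring

/-- `((A ⊗ B ⊗ C)·t)_{a'b'c'} = ∑_{a,b} A_{a'a} B_{b'b} · ∑_c C_{c'c} t_{abc}`. [folklore] -/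
theorem actTensor_eq_sum₃ (A : Matrix ι' ι K) (B : Matrix κ' κ K) (C : Matrix μ' μ K)
    (t : ι → κ → μ → K) (a' : ι') (b' : κ') (c' : μ') :
    actTensor A B C t a' b' c' = ∑ a, ∑ b, A a' a * B b' b * ∑ c, C c' c * t a b c := by
  rw [actTensor_apply]
  refine Finset.sum_congr rfl fun a _ => Finset.sum_congr rfl fun b _ => ?_
  rw [Finset.mul_sum]
  exact Finset.sum_congr rfl fun c _ => by ring

/-- If the `a'`-th transformed `x`-slice `∑_a A_{a'a} t_{a··}` vanishes, then the `a'`-th slice of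
`(A ⊗ B ⊗ C)·t` vanishes (the three factors act independently). [folklore] -/
theorem actTensor_eq_zero_of_xSlices₁ (A : Matrix ι' ι K) (B : Matrix κ' κ K) (C : Matrix μ' μ K)
    (t : ι → κ → μ → K) {a' : ι'} (h : ∑ a, A a' a • xSlices t a = 0) (b' : κ') (c' : μ') :
    actTensor A B C t a' b' c' = 0 := by
  rw [actTensor_eq_sum₁]
  refine Finset.sum_eq_zero fun b _ => Finset.sum_eq_zero fun c _ => ?_
  have hbc := congrFun h (b, c)
  simp only [Finset.sum_apply, Pi.smul_apply, xSlices_apply, smul_eq_mul, Pi.zero_apply] at hbc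
  rw [hbc, mul_zero]

/-- The same along the second factor, with the `y`-slices written as the `x`-slices of `rotate t`.
[folklore] -/
theorem actTensor_eq_zero_of_xSlices₂ (A : Matrix ι' ι K) (B : Matrix κ' κ K) (C : Matrix μ' μ K)
    (t : ι → κ → μ → K) {b' : κ'} (h : ∑ b, B b' b • xSlices (rotate t) b = 0) (a' : ι')
    (c' : μ') : actTensor A B C t a' b' c' = 0 := by
  rw [actTensor_eq_sum₂]
  refine Finset.sum_eq_zero fun a _ => Finset.sum_eq_zero fun c _ => ?_
  have hca := congrFun h (c, a)
  simp only [Finset.sum_apply, Pi.smul_apply, xSlices_apply, rotate_apply, smul_eq_mul,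
    Pi.zero_apply] at hca
  rw [hca, mul_zero]

/-- The same along the third factor, with the `z`-slices written as the `x`-slices of
`rotate (rotate t)`. [folklore] -/
theorem actTensor_eq_zero_of_xSlices₃ (A : Matrix ι' ι K) (B : Matrix κ' κ K) (C : Matrix μ' μ K)
    (t : ι → κ → μ → K) {c' : μ'} (h : ∑ c, C c' c • xSlices (rotate (rotate t)) c = 0) (a' : ι')
    (b' : κ') : actTensor A B C t a' b' c' = 0 := by
  rw [actTensor_eq_sum₃]
  refine Finset.sum_eq_zero fun a _ => Finset.sum_eq_zero fun b _ => ?_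
  have hab := congrFun h (a, b)
  simp only [Finset.sum_apply, Pi.smul_apply, xSlices_apply, rotate_apply, smul_eq_mul,
    Pi.zero_apply] at hab
  rw [hab, mul_zero]

end SupportBox

/-! ## Entropy of distributions with restricted support -/

section Entropy

/-- A probability distribution vanishing outside a finite set `S` has Shannon entropy at most
`log₂ |S|` (the entropy of its restriction to `S`, which is at most `log₂ |S|`). [folklore] -/
theorem shannonEntropy_le_log_card {α : Type*} [Fintype α] {P : α → ℝ} (hP : P ∈ stdSimplex ℝ α)
    (S : Finset α) (hS : ∀ x, x ∉ S → P x = 0) :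
    shannonEntropy P ≤ Real.log S.card / Real.log 2 := by
  have hsum : ∑ x ∈ S, P x = 1 := by
    rw [Finset.sum_subset (Finset.subset_univ S) fun x _ hx => hS x hx]
    exact hP.2
  have hP' : (fun x : S => P x) ∈ stdSimplex ℝ S := by
    refine ⟨fun x => hP.1 x, ?_⟩
    show ∑ x : S, P x = 1
    rw [Finset.sum_coe_sort S P, hsum]
  have hH : shannonEntropy P = shannonEntropy fun x : S => P x := by
    simp only [shannonEntropy_def]
    congr 1
    calc ∑ x, Real.negMulLog (P x) = ∑ x ∈ S, Real.negMulLog (P x) :=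
          (Finset.sum_subset (Finset.subset_univ S) fun x _ hx => by
            rw [hS x hx, Real.negMulLog_zero]).symm
      _ = ∑ x : S, Real.negMulLog (P x) := (Finset.sum_coe_sort S _).symm
  rw [hH]
  simpa only [Fintype.card_coe] using shannonEntropy_le_of_mem_stdSimplex hP'

/-- If a probability distribution on `ι × κ × μ` vanishes outside a box `S₁ × S₂ × S₃`, then its
marginals vanish outside `S₁`, `S₂`, `S₃`, so `H_θ(P) ≤ θ₁ log₂|S₁| + θ₂ log₂|S₂| + θ₃ log₂|S₃|`
for `θ ≥ 0`. [folklore] -/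
theorem weightedEntropy_le_of_support_subset_box {ι κ μ : Type*} [Fintype ι] [Fintype κ]
    [Fintype μ] {θ : Fin 3 → ℝ} (hθ : ∀ i, 0 ≤ θ i) {P : ι × κ × μ → ℝ}
    (hP : P ∈ stdSimplex ℝ (ι × κ × μ)) (S₁ : Finset ι) (S₂ : Finset κ) (S₃ : Finset μ)
    (hS : ∀ p, P p ≠ 0 → p.1 ∈ S₁ ∧ p.2.1 ∈ S₂ ∧ p.2.2 ∈ S₃) :
    weightedEntropy θ P ≤ θ 0 * (Real.log S₁.card / Real.log 2) +
      θ 1 * (Real.log S₂.card / Real.log 2) + θ 2 * (Real.log S₃.card / Real.log 2) := by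
  have h₁ : shannonEntropy (marginalDist₁ P) ≤ Real.log S₁.card / Real.log 2 :=
    shannonEntropy_le_log_card (marginalDist₁_mem_stdSimplex hP) S₁ fun a ha =>
      show ∑ b, ∑ c, P (a, b, c) = 0 from
        Finset.sum_eq_zero fun b _ => Finset.sum_eq_zero fun c _ => by
          by_contra h
          exact ha (hS _ h).1
  have h₂ : shannonEntropy (marginalDist₂ P) ≤ Real.log S₂.card / Real.log 2 :=
    shannonEntropy_le_log_card (marginalDist₂_mem_stdSimplex hP) S₂ fun b hb =>
      show ∑ a, ∑ c, P (a, b, c) = 0 from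
        Finset.sum_eq_zero fun a _ => Finset.sum_eq_zero fun c _ => by
          by_contra h
          exact hb (hS _ h).2.1
  have h₃ : shannonEntropy (marginalDist₃ P) ≤ Real.log S₃.card / Real.log 2 :=
    shannonEntropy_le_log_card (marginalDist₃_mem_stdSimplex hP) S₃ fun c hc =>
      show ∑ a, ∑ b, P (a, b, c) = 0 from
        Finset.sum_eq_zero fun a _ => Finset.sum_eq_zero fun b _ => by
          by_contra h
          exact hc (hS _ h).2.2
  exact add_le_add (add_le_add (mul_le_mul_of_nonneg_left h₁ (hθ 0))
    (mul_le_mul_of_nonneg_left h₂ (hθ 1))) (mul_le_mul_of_nonneg_left h₃ (hθ 2))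

end Entropy

/-! ## `ρ^θ ≤ ∑ θ_i log₂ ζ⁽ⁱ⁾` and `ζ^θ ≤ R̃` -/

section Main

variable {K : Type u} [Field K] {ι κ μ : Type*} [Fintype ι] [Fintype κ] [Fintype μ]
  [DecidableEq ι] [DecidableEq κ] [DecidableEq μ]

/-- **Strassen's bound of the upper support functional by the flattening ranks** ([Str91, p. 135]
as quoted by CLLZ, proof of Lemma 4.2), in the weighted logarithmic form
`ρ^θ(t) ≤ θ₁ log₂ ζ⁽¹⁾(t) + θ₂ log₂ ζ⁽²⁾(t) + θ₃ log₂ ζ⁽³⁾(t)` for `θ ≥ 0` (the last two flattening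
ranks as `flatteningRank` of the rotated tensor): after the three eliminations the support lies in a
box with `ζ⁽ⁱ⁾(t)` points in direction `i`, and `H(P_i) ≤ log₂ ζ⁽ⁱ⁾(t)` for every distribution on
it. [cite: ChristandlLeGallLysikovZuiddam2025, Lemma 4.2 (proof)] -/
theorem logUpperSupportFunctional_le_flatteningRank {θ : Fin 3 → ℝ} (hθ : ∀ i, 0 ≤ θ i)
    (t : ι → κ → μ → K) :
    logUpperSupportFunctional θ t ≤ θ 0 * (Real.log (flatteningRank t) / Real.log 2) +
      θ 1 * (Real.log (flatteningRank (rotate t)) / Real.log 2) +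
      θ 2 * (Real.log (flatteningRank (rotate (rotate t))) / Real.log 2) := by
  obtain ⟨A, S₁, hS₁, hA⟩ := exists_gl_sum_smul_eq_zero (K := K) (xSlices t)
  obtain ⟨B, S₂, hS₂, hB⟩ := exists_gl_sum_smul_eq_zero (K := K) (xSlices (rotate t))
  obtain ⟨C, S₃, hS₃, hC⟩ := exists_gl_sum_smul_eq_zero (K := K) (xSlices (rotate (rotate t)))
  -- the support of `(A ⊗ B ⊗ C)·t` lies in the box `S₁ × S₂ × S₃`
  have hbox : ∀ p : ι × κ × μ, actTensor (A : Matrix ι ι K) (B : Matrix κ κ K) (C : Matrix μ μ K) t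
      p.1 p.2.1 p.2.2 ≠ 0 → p.1 ∈ S₁ ∧ p.2.1 ∈ S₂ ∧ p.2.2 ∈ S₃ := by
    rintro ⟨a', b', c'⟩ h
    refine ⟨?_, ?_, ?_⟩ <;> by_contra hn
    · exact h (actTensor_eq_zero_of_xSlices₁ _ _ _ _ (hA a' hn) _ _)
    · exact h (actTensor_eq_zero_of_xSlices₂ _ _ _ _ (hB b' hn) _ _)
    · exact h (actTensor_eq_zero_of_xSlices₃ _ _ _ _ (hC c' hn) _ _)
  have hf₁ : flatteningRank t = S₁.card := hS₁.symm
  have hf₂ : flatteningRank (rotate t) = S₂.card := hS₂.symm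
  have hf₃ : flatteningRank (rotate (rotate t)) = S₃.card := hS₃.symm
  have hbdd : BddBelow (Set.range fun g : GL ι K × GL κ K × GL μ K =>
      maxWeightedEntropy θ (tensorSupport (actTensor (g.1 : Matrix ι ι K) (g.2.1 : Matrix κ κ K)
        (g.2.2 : Matrix μ μ K) t))) :=
    ⟨0, by
      rintro _ ⟨g, rfl⟩
      exact maxWeightedEntropy_nonneg hθ _⟩
  refine (ciInf_le hbdd (A, B, C)).trans ?_
  show maxWeightedEntropy θ (tensorSupport
    (actTensor (A : Matrix ι ι K) (B : Matrix κ κ K) (C : Matrix μ μ K) t)) ≤ _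
  refine Real.sSup_le ?_ ?_
  · rintro _ ⟨P, ⟨hP, hsupp⟩, rfl⟩
    rw [hf₁, hf₂, hf₃]
    exact weightedEntropy_le_of_support_subset_box hθ hP S₁ S₂ S₃ fun p hp => hbox p (hsupp hp)
  · have hl : ∀ n : ℕ, 0 ≤ Real.log n / Real.log 2 := fun n =>
      div_nonneg (Real.log_natCast_nonneg n) (Real.log_nonneg one_le_two)
    exact add_nonneg (add_nonneg (mul_nonneg (hθ 0) (hl _)) (mul_nonneg (hθ 1) (hl _)))
      (mul_nonneg (hθ 2) (hl _))

/-- **`ζ^θ(t) ≤ R̃(t)`** for every field `K`, every `θ ∈ P([3])` and every 3-tensor `t` with finite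
index types — CLLZ Def. 3.1 (v) for the upper support functionals, the last item of Lemma 4.2
("every upper support functional is at most the maximum of the flattening ranks of the tensor
[Str91, page 135], and the flattening ranks lower bound the asymptotic rank"): by
`logUpperSupportFunctional_le_flatteningRank`, `ζ⁽ⁱ⁾ ≤ R̃` and `∑ θ_i = 1`,
`ζ^θ(t) = 2^{ρ^θ(t)} ≤ 2^{log₂ R̃(t)} = R̃(t)` (`t ≠ 0`; `ζ^θ(0) = 0`).
[cite: ChristandlLeGallLysikovZuiddam2025, Lemma 4.2] -/
theorem upperSupportFunctional_le_asymptoticRank {θ : Fin 3 → ℝ} (hθ : θ ∈ stdSimplex ℝ (Fin 3))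
    (t : ι → κ → μ → K) : upperSupportFunctional θ t ≤ asymptoticRank t := by
  by_cases ht : t = 0
  · subst ht
    rw [upperSupportFunctional_zero]
    exact asymptoticRank_nonneg _
  obtain ⟨hR₁, hR₂, hR₃⟩ := flatteningRank_rotate_le_asymptoticRank t
  have h₁ : 0 < flatteningRank t := flatteningRank_pos ht
  have h₂ : 0 < flatteningRank (rotate t) := flatteningRank_pos (rotate_ne_zero ht)
  have h₃ : 0 < flatteningRank (rotate (rotate t)) :=
    flatteningRank_pos (rotate_ne_zero (rotate_ne_zero ht))
  have hRpos : 0 < asymptoticRank t :=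
    lt_of_lt_of_le (show (0 : ℝ) < flatteningRank t by exact_mod_cast h₁) hR₁
  have hlog : ∀ {n : ℕ} {r : ℝ}, 0 < n → (n : ℝ) ≤ r → Real.log n ≤ Real.log r :=
    fun hn hr => Real.log_le_log (by exact_mod_cast hn) hr
  have key : logUpperSupportFunctional θ t ≤ Real.logb 2 (asymptoticRank t) := by
    refine (logUpperSupportFunctional_le_flatteningRank hθ.1 t).trans ?_
    have hL : 0 < Real.log 2 := Real.log_pos one_lt_two
    have hsum : θ 0 + θ 1 + θ 2 = 1 := by
      have h := hθ.2
      simpa [Fin.sum_univ_three] using h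
    have e₁ := div_le_div_of_nonneg_right (hlog h₁ hR₁) hL.le
    have e₂ := div_le_div_of_nonneg_right (hlog h₂ hR₂) hL.le
    have e₃ := div_le_div_of_nonneg_right (hlog h₃ hR₃) hL.le
    calc θ 0 * (Real.log (flatteningRank t) / Real.log 2) +
          θ 1 * (Real.log (flatteningRank (rotate t)) / Real.log 2) +
          θ 2 * (Real.log (flatteningRank (rotate (rotate t))) / Real.log 2)
        ≤ θ 0 * (Real.log (asymptoticRank t) / Real.log 2) +
          θ 1 * (Real.log (asymptoticRank t) / Real.log 2) +
          θ 2 * (Real.log (asymptoticRank t) / Real.log 2) :=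
          add_le_add (add_le_add (mul_le_mul_of_nonneg_left e₁ (hθ.1 0))
            (mul_le_mul_of_nonneg_left e₂ (hθ.1 1))) (mul_le_mul_of_nonneg_left e₃ (hθ.1 2))
      _ = Real.logb 2 (asymptoticRank t) := by
          rw [Real.logb, ← add_mul, ← add_mul, hsum, one_mul]
  have hne : upperSupportFunctional θ t = (2 : ℝ) ^ logUpperSupportFunctional θ t := if_neg ht
  rw [hne]
  calc (2 : ℝ) ^ logUpperSupportFunctional θ t ≤ (2 : ℝ) ^ Real.logb 2 (asymptoticRank t) :=
        Real.rpow_le_rpow_of_exponent_le one_le_two key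
    _ = asymptoticRank t := Real.rpow_logb two_pos (by norm_num) hRpos

end Main

/-! ## The discharge -/

/-- **CLLZ Lemma 4.2, item (v), PROVED**: `ζ^θ(t) ≤ R̃(t)` for every field, every `θ ∈ P([3])`
and every 3-tensor — the named fact `CLLZ2025_lem42_v` of `RectangularBarrier.lean` holds
(`upperSupportFunctional_le_asymptoticRank`). [cite: ChristandlLeGallLysikovZuiddam2025, Lemma 4.2] -/
theorem CLLZ2025_lem42_v_holds : CLLZ2025_lem42_v :=
  fun K _ _ hθ _ _ _ _ _ _ _ _ _ t => upperSupportFunctional_le_asymptoticRank (K := K) hθ t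

/-- With item (v) discharged, **CLLZ Lemma 4.2 — the upper support functionals are adequate —
holds conditionally only on Strassen's theorem (`Strassen1991_upperSupportFunctional`: (i), (ii),
(iv), normalisation) and the product formula of Lemma 4.1 (`CLLZ2025_lem41`, giving (iii))**.
[cite: ChristandlLeGallLysikovZuiddam2025, Lemma 4.2] -/
theorem CLLZ2025_lem42'
    (hS : Literature.Computability.AlgebraicComplexity.Strassen1991_upperSupportFunctional.{0})
    (h41 : CLLZ2025_lem41) (K : Type) [Field K] {θ : Fin 3 → ℝ} (hθ : θ ∈ stdSimplex ℝ (Fin 3)) :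
    IsAdequate K (upperSupportPoint K θ) :=
  CLLZ2025_lem42 hS h41 CLLZ2025_lem42_v_holds K hθ

end Literature.Barriers.MatrixMultiplication

end
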